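import Summits.HodgeConjecture.HodgeConjecture.Theses.HeckePrymWeil
import Summits.HodgeConjecture.HodgeConjecture.Theorems.WeilTenfoldsSqrtMinus11.Negative.EigenvalueSeparation
import Summits.HodgeConjecture.HodgeConjecture.Theorems.WeilTenfoldsSqrtMinus11.Negative.KillPropagation
import Summits.HodgeConjecture.HodgeConjecture.Theorems.WeilTenfoldsSqrtMinus11.Negative.WeilPlaneKernel
import Literature.AlgebraicGeometry.Motives.AbelianVarietyProduct
import Literature.AlgebraicGeometry.Motives.AbelianVarietyProductDimProofs
import Literature.AlgebraicGeometry.Motives.HyperbolicWeilType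
import Literature.AlgebraicGeometry.HodgeTheory.SemiregularVariationalHodge
import Literature.AlgebraicGeometry.HodgeTheory.KaehlerClass

/-!
# `WeilTenfoldsSqrtMinus11` (stmt-HodgeConjecture-1262) · Negative · where the PICKED line's stubs sit

Negative-side knowledge for the crux `HeckePrymWeil.WeilTenfoldsSqrtMinus11`, from the standing disprover's work
file `Cruxes/WeilTenfoldsSqrtMinus11/Disproof.lean` §D (refuter-cdisprove-stmt-HodgeConjecture-1262-g3-0, cycle 3,
2026-08-16). The lead picked line `generic-ppav-secant-descent` (skeleton `Lines/generic-ppav-secant-descent.lean`,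
sha 7545e3bc, six registered stubs). The skeleton carries `sorry`s and cannot be imported, so the stubs' statements
are written out VERBATIM below (no new definition). What a kill of each stub would mean:

* S1 `stub_secantSpread` (the bet) = "an anchor EXISTS ∧ Weil classes SPREAD from it". The spreading block holds for
  ARBITRARY anchor data under the summit (`secantSpreadFrom_of_hodgeConjecture`: the class `w s` is rational `(6,6)`
  on the smooth projective fibre, `IsSmoothProjectiveFamily.isSmoothProjective`), so under HC the stub is EQUIVALENT to
  the bare existence of a split, `K`-compatibly Kähler-polarised, hyperbolic `ℚ(√-11)`-twelvefold
  (`stubSecantSpread_of_hodgeConjecture_of_anchor`, `exists_anchor_of_stubSecantSpread`) — classically Markman's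
  `X × X̂` (arXiv:2502.03415 Lemma 3.1.3), e.g. `E⁶ × E⁶` for any elliptic curve; the ENDOMORPHISM half of the anchor
  (`ψ₀² = -11`, split idempotent `e₀`) is constructed here on every square `X × X`
  (`exists_offDiagonal_on_square`, `exists_twelvefold_offDiagonal_of_sixfold`), so only the cohomological
  half (`h₀`, the hyperbolic frame) waits for Künneth. Refutation shape: `¬HC`.
* S2 `stub_moduliReach`: its conclusion block is the rung predicate `HWA(11, 6)` RESTRICTED to hyperbolic polarised
  members (`stubModuliReachCore_of_hwa11_six`; the six polarisation hypotheses are dropped), hence a consequence of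
  the summit (`stubModuliReachCore_of_hodgeConjecture`) and of the route's own `HodgeWeilLadder ∧ WeilDescending`
  (`hwa11_six_of_ladder`: rung `(11,3)` is `HWA(11,10)`, descend four times). Dimension `12 = 2·6` is NOT a
  Hecke–Prym rung (`6 ∉ 5ℕ`). A refutation of S2's conclusion refutes `HWA(11,6)`, never the crux directly.
* S6 `stub_descent` is WEAKER THAN THE CRUX (`stubDescentCore_of_weilTenfoldsSqrtMinus11`: forget the partner
  surface), so it is never the obstacle; the integer arithmetic of its projector step is the sibling file
  `DescentProjector`.
* S3 `stub_aimingArithmetic`: see the sibling file `AimingTightness` (both deletable hypotheses are load-bearing).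
* S4 `stub_hyperbolicPartner` (a construction) and S5 `stub_hodgeTypeExterior` (Künneth): no typed handle.
-/

noncomputable section

namespace Summit.HodgeConjecture.HodgeConjecture.Theorems.WeilTenfoldsSqrtMinus11.Negative

open Summit.HodgeConjecture.HodgeConjecture.Theses.HeckePrymWeil
open CategoryTheory Complex Literature.AlgebraicGeometry Literature.AlgebraicGeometry.Motives
  Literature.AlgebraicGeometry.HodgeTheory Literature.AlgebraicTopology.SingularHomology
open Summit.HodgeConjecture.HodgeConjecture.Theorems.WeilTwelvefoldsSqrtMinus7.Negative (descend_logic)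

/-! ### S1 `stub_secantSpread` -/

/-- **The spreading block of `stub_secantSpread` follows from the summit for ARBITRARY anchor data
`(A₀, ψ₀, h₀)`** (verbatim the stub's universal clause): `w s` is a rational `(6,6)` class on the smooth
projective twelvefold `𝒳_s`, so HC makes it algebraic; `ψ₀`, the polarisation and the Weil plane are not used.
[cite: Deligne2000, §1] -/
theorem secantSpreadFrom_of_hodgeConjecture (hHC : _root_.HodgeConjecture) (A₀ : AbelianVariety ℂ)
    (ψ₀ : A₀ ⟶ A₀) (h₀ : complexBetti A₀.X 2) :
    ∀ (𝒳 S : SchemeOver ℂ) (π : 𝒳 ⟶ S),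
        IsSmoothProjectiveFamily π 12 → IsQuasiProjectiveOver S →
        _root_.AlgebraicGeometry.IsIntegral S.left → _root_.AlgebraicGeometry.Smooth S.hom →
      ∀ (hh : ∀ s : ComplexPoints S, complexBetti (fiberOver π s) (2 * 1))
        (w : ∀ s : ComplexPoints S, complexBetti (fiberOver π s) (2 * 6)),
        Continuous (fun s => (⟨s, hh s⟩ : FiberClass π (2 * 1))) →
        Continuous (fun s => (⟨s, w s⟩ : FiberClass π (2 * 6))) →
        (∀ s, (⟨s, hh s⟩ : FiberClass π (2 * 1)) ∈ locusOfHodgeClasses π 12 1) →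
        (∀ s, (⟨s, w s⟩ : FiberClass π (2 * 6)) ∈ locusOfHodgeClasses π 12 6) →
      ∀ (s₀ : ComplexPoints S) (ι₀ : fiberOver π s₀ ≅ A₀.X) (c₀ : complexBetti A₀.X 12),
        c₀ ∈ Module.End.eigenspace (complexBetti.map (𝟙 A₀ + ψ₀).hom.hom.hom 12).hom
                ((1 + Complex.I * (Real.sqrt (11 : ℝ) : ℂ)) ^ 12) ⊔
              Module.End.eigenspace (complexBetti.map (𝟙 A₀ + ψ₀).hom.hom.hom 12).hom
                ((1 - Complex.I * (Real.sqrt (11 : ℝ) : ℂ)) ^ 12) →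
        hh s₀ = complexBetti.map ι₀.hom (2 * 1) h₀ →
        w s₀ = complexBetti.map ι₀.hom (2 * 6) c₀ →
      ∀ s : ComplexPoints S, w s ∈ algebraicClasses (fiberOver π s) 6 := by
  intro 𝒳 S π hπ _ _ _ hh w _ _ _ hw s₀ ι₀ c₀ _ _ _ s
  exact (hHC (hπ.isSmoothProjective s)).2 6 (w s) (hw s).1 (hw s).2

/-- **Under HC, `stub_secantSpread` follows from the bare existence of an anchor** (its eleven existential
conjuncts; the statement below the `→` is the stub VERBATIM). [cite: Deligne2000, §1] -/
theorem stubSecantSpread_of_hodgeConjecture_of_anchor (hHC : _root_.HodgeConjecture)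
    (hA : ∃ (A₀ : AbelianVariety ℂ) (ψ₀ e₀ : A₀ ⟶ A₀) (h₀ : complexBetti A₀.X 2),
      A₀.dim = 12 ∧ ψ₀ ≫ ψ₀ = -((11 : ℤ) • 𝟙 A₀) ∧
      e₀ ≫ e₀ = e₀ ∧ e₀ ≫ ψ₀ ≫ e₀ = 0 ∧ (𝟙 A₀ - e₀) ≫ ψ₀ ≫ (𝟙 A₀ - e₀) = 0 ∧
      IsRationalClass h₀ ∧ h₀ ∈ algebraicClasses A₀.X 1 ∧
      complexBetti.map ψ₀.hom.hom.hom 2 h₀ = (11 : ℂ) • h₀ ∧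
      (∀ x : complexBetti A₀.X 1,
        (∀ y : complexBetti A₀.X 1, polarizationPairingOne A₀.X h₀ 11 x y = 0) → x = 0) ∧
      IsKaehlerClass 12 A₀.X h₀ ∧ IsHyperbolicWeilType A₀ ψ₀ 6 h₀) :
    ∃ (A₀ : AbelianVariety ℂ) (ψ₀ e₀ : A₀ ⟶ A₀) (h₀ : complexBetti A₀.X 2),
      A₀.dim = 12 ∧ ψ₀ ≫ ψ₀ = -((11 : ℤ) • 𝟙 A₀) ∧
      e₀ ≫ e₀ = e₀ ∧ e₀ ≫ ψ₀ ≫ e₀ = 0 ∧ (𝟙 A₀ - e₀) ≫ ψ₀ ≫ (𝟙 A₀ - e₀) = 0 ∧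
      IsRationalClass h₀ ∧ h₀ ∈ algebraicClasses A₀.X 1 ∧
      complexBetti.map ψ₀.hom.hom.hom 2 h₀ = (11 : ℂ) • h₀ ∧
      (∀ x : complexBetti A₀.X 1,
        (∀ y : complexBetti A₀.X 1, polarizationPairingOne A₀.X h₀ 11 x y = 0) → x = 0) ∧
      IsKaehlerClass 12 A₀.X h₀ ∧ IsHyperbolicWeilType A₀ ψ₀ 6 h₀ ∧
      ∀ (𝒳 S : SchemeOver ℂ) (π : 𝒳 ⟶ S),
        IsSmoothProjectiveFamily π 12 → IsQuasiProjectiveOver S →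
        _root_.AlgebraicGeometry.IsIntegral S.left → _root_.AlgebraicGeometry.Smooth S.hom →
      ∀ (hh : ∀ s : ComplexPoints S, complexBetti (fiberOver π s) (2 * 1))
        (w : ∀ s : ComplexPoints S, complexBetti (fiberOver π s) (2 * 6)),
        Continuous (fun s => (⟨s, hh s⟩ : FiberClass π (2 * 1))) →
        Continuous (fun s => (⟨s, w s⟩ : FiberClass π (2 * 6))) →
        (∀ s, (⟨s, hh s⟩ : FiberClass π (2 * 1)) ∈ locusOfHodgeClasses π 12 1) →
        (∀ s, (⟨s, w s⟩ : FiberClass π (2 * 6)) ∈ locusOfHodgeClasses π 12 6) →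
      ∀ (s₀ : ComplexPoints S) (ι₀ : fiberOver π s₀ ≅ A₀.X) (c₀ : complexBetti A₀.X 12),
        c₀ ∈ Module.End.eigenspace (complexBetti.map (𝟙 A₀ + ψ₀).hom.hom.hom 12).hom
                ((1 + Complex.I * (Real.sqrt (11 : ℝ) : ℂ)) ^ 12) ⊔
              Module.End.eigenspace (complexBetti.map (𝟙 A₀ + ψ₀).hom.hom.hom 12).hom
                ((1 - Complex.I * (Real.sqrt (11 : ℝ) : ℂ)) ^ 12) →
        hh s₀ = complexBetti.map ι₀.hom (2 * 1) h₀ →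
        w s₀ = complexBetti.map ι₀.hom (2 * 6) c₀ →
      ∀ s : ComplexPoints S, w s ∈ algebraicClasses (fiberOver π s) 6 := by
  obtain ⟨A₀, ψ₀, e₀, h₀, h1, h2, h3, h4, h5, h6, h7, h8, h9, h10, h11⟩ := hA
  exact ⟨A₀, ψ₀, e₀, h₀, h1, h2, h3, h4, h5, h6, h7, h8, h9, h10, h11,
    secantSpreadFrom_of_hodgeConjecture hHC A₀ ψ₀ h₀⟩

/-- Conversely `stub_secantSpread` (VERBATIM, the hypothesis) hands out its anchor. [folklore] -/
theorem exists_anchor_of_stubSecantSpread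
    (h : ∃ (A₀ : AbelianVariety ℂ) (ψ₀ e₀ : A₀ ⟶ A₀) (h₀ : complexBetti A₀.X 2),
      A₀.dim = 12 ∧ ψ₀ ≫ ψ₀ = -((11 : ℤ) • 𝟙 A₀) ∧
      e₀ ≫ e₀ = e₀ ∧ e₀ ≫ ψ₀ ≫ e₀ = 0 ∧ (𝟙 A₀ - e₀) ≫ ψ₀ ≫ (𝟙 A₀ - e₀) = 0 ∧
      IsRationalClass h₀ ∧ h₀ ∈ algebraicClasses A₀.X 1 ∧
      complexBetti.map ψ₀.hom.hom.hom 2 h₀ = (11 : ℂ) • h₀ ∧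
      (∀ x : complexBetti A₀.X 1,
        (∀ y : complexBetti A₀.X 1, polarizationPairingOne A₀.X h₀ 11 x y = 0) → x = 0) ∧
      IsKaehlerClass 12 A₀.X h₀ ∧ IsHyperbolicWeilType A₀ ψ₀ 6 h₀ ∧
      ∀ (𝒳 S : SchemeOver ℂ) (π : 𝒳 ⟶ S),
        IsSmoothProjectiveFamily π 12 → IsQuasiProjectiveOver S →
        _root_.AlgebraicGeometry.IsIntegral S.left → _root_.AlgebraicGeometry.Smooth S.hom →
      ∀ (hh : ∀ s : ComplexPoints S, complexBetti (fiberOver π s) (2 * 1))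
        (w : ∀ s : ComplexPoints S, complexBetti (fiberOver π s) (2 * 6)),
        Continuous (fun s => (⟨s, hh s⟩ : FiberClass π (2 * 1))) →
        Continuous (fun s => (⟨s, w s⟩ : FiberClass π (2 * 6))) →
        (∀ s, (⟨s, hh s⟩ : FiberClass π (2 * 1)) ∈ locusOfHodgeClasses π 12 1) →
        (∀ s, (⟨s, w s⟩ : FiberClass π (2 * 6)) ∈ locusOfHodgeClasses π 12 6) →
      ∀ (s₀ : ComplexPoints S) (ι₀ : fiberOver π s₀ ≅ A₀.X) (c₀ : complexBetti A₀.X 12),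
        c₀ ∈ Module.End.eigenspace (complexBetti.map (𝟙 A₀ + ψ₀).hom.hom.hom 12).hom
                ((1 + Complex.I * (Real.sqrt (11 : ℝ) : ℂ)) ^ 12) ⊔
              Module.End.eigenspace (complexBetti.map (𝟙 A₀ + ψ₀).hom.hom.hom 12).hom
                ((1 - Complex.I * (Real.sqrt (11 : ℝ) : ℂ)) ^ 12) →
        hh s₀ = complexBetti.map ι₀.hom (2 * 1) h₀ →
        w s₀ = complexBetti.map ι₀.hom (2 * 6) c₀ →
      ∀ s : ComplexPoints S, w s ∈ algebraicClasses (fiberOver π s) 6) :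
    ∃ (A₀ : AbelianVariety ℂ) (ψ₀ e₀ : A₀ ⟶ A₀) (h₀ : complexBetti A₀.X 2),
      A₀.dim = 12 ∧ ψ₀ ≫ ψ₀ = -((11 : ℤ) • 𝟙 A₀) ∧
      e₀ ≫ e₀ = e₀ ∧ e₀ ≫ ψ₀ ≫ e₀ = 0 ∧ (𝟙 A₀ - e₀) ≫ ψ₀ ≫ (𝟙 A₀ - e₀) = 0 ∧
      IsRationalClass h₀ ∧ h₀ ∈ algebraicClasses A₀.X 1 ∧
      complexBetti.map ψ₀.hom.hom.hom 2 h₀ = (11 : ℂ) • h₀ ∧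
      (∀ x : complexBetti A₀.X 1,
        (∀ y : complexBetti A₀.X 1, polarizationPairingOne A₀.X h₀ 11 x y = 0) → x = 0) ∧
      IsKaehlerClass 12 A₀.X h₀ ∧ IsHyperbolicWeilType A₀ ψ₀ 6 h₀ := by
  obtain ⟨A₀, ψ₀, e₀, h₀, h1, h2, h3, h4, h5, h6, h7, h8, h9, h10, h11, _⟩ := h
  exact ⟨A₀, ψ₀, e₀, h₀, h1, h2, h3, h4, h5, h6, h7, h8, h9, h10, h11⟩

/-! #### The endomorphism half of the anchor block is constructible on any square `X × X` -/

/-- **The endomorphism half of the anchor block is satisfiable on EVERY square `X × X`**: the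
off-diagonal `ψ₀ = (0, -11; 1, 0)` (`(x, y) ↦ (-11y, x)`) has `ψ₀ ≫ ψ₀ = -11`, and `e₀ = pr₁`
(`(x, y) ↦ (x, 0)`) is an idempotent with `e₀ψ₀e₀ = 0 = (𝟙 - e₀)ψ₀(𝟙 - e₀)` — pure algebra in the
preadditive category `AbelianVariety ℂ` with its products (`prodLift`, `fst`, `snd`). For Markman's
anchor take `X` a principally polarised sixfold and read the second factor as `X̂ ≅ X`. [folklore] -/
theorem exists_offDiagonal_on_square (X : AbelianVariety ℂ) :
    ∃ (ψ₀ e₀ : X.prod X ⟶ X.prod X), ψ₀ ≫ ψ₀ = -((11 : ℤ) • 𝟙 (X.prod X)) ∧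
      e₀ ≫ e₀ = e₀ ∧ e₀ ≫ ψ₀ ≫ e₀ = 0 ∧ (𝟙 (X.prod X) - e₀) ≫ ψ₀ ≫ (𝟙 (X.prod X) - e₀) = 0 := by
  let F : X.prod X ⟶ X := AbelianVariety.fst X X
  let S : X.prod X ⟶ X := AbelianVariety.snd X X
  let ψ₀ : X.prod X ⟶ X.prod X := AbelianVariety.prodLift (-((11 : ℤ) • S)) F
  let e₀ : X.prod X ⟶ X.prod X := AbelianVariety.prodLift F 0
  have hψF : ψ₀ ≫ F = -((11 : ℤ) • S) := AbelianVariety.prodLift_fst _ _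
  have hψS : ψ₀ ≫ S = F := AbelianVariety.prodLift_snd _ _
  have heF : e₀ ≫ F = F := AbelianVariety.prodLift_fst _ _
  have heS : e₀ ≫ S = 0 := AbelianVariety.prodLift_snd _ _
  refine ⟨ψ₀, e₀, ?_, ?_, ?_, ?_⟩
  · apply AbelianVariety.prod_hom_ext
    · change (ψ₀ ≫ ψ₀) ≫ F = _ ≫ F
      rw [Category.assoc, hψF, Preadditive.comp_neg, Preadditive.comp_zsmul, hψS,
        Preadditive.neg_comp, Preadditive.zsmul_comp, Category.id_comp]
    · change (ψ₀ ≫ ψ₀) ≫ S = _ ≫ S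
      rw [Category.assoc, hψS, hψF, Preadditive.neg_comp, Preadditive.zsmul_comp, Category.id_comp]
  · apply AbelianVariety.prod_hom_ext
    · change (e₀ ≫ e₀) ≫ F = e₀ ≫ F
      rw [Category.assoc, heF, heF]
    · change (e₀ ≫ e₀) ≫ S = e₀ ≫ S
      rw [Category.assoc, heS, Limits.comp_zero]
  · apply AbelianVariety.prod_hom_ext
    · change (e₀ ≫ ψ₀ ≫ e₀) ≫ F = (0 : X.prod X ⟶ X.prod X) ≫ F
      rw [Category.assoc, Category.assoc, heF, hψF, Preadditive.comp_neg, Preadditive.comp_zsmul, heS,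
        smul_zero, neg_zero, Limits.zero_comp]
    · change (e₀ ≫ ψ₀ ≫ e₀) ≫ S = (0 : X.prod X ⟶ X.prod X) ≫ S
      rw [Category.assoc, Category.assoc, heS, Limits.comp_zero, Limits.comp_zero, Limits.zero_comp]
  · have h1F : (𝟙 (X.prod X) - e₀) ≫ F = 0 := by
      rw [Preadditive.sub_comp, Category.id_comp, heF, sub_self]
    have h1S : (𝟙 (X.prod X) - e₀) ≫ S = S := by
      rw [Preadditive.sub_comp, Category.id_comp, heS, sub_zero]
    apply AbelianVariety.prod_hom_ext
    · change ((𝟙 (X.prod X) - e₀) ≫ ψ₀ ≫ (𝟙 (X.prod X) - e₀)) ≫ F = (0 : X.prod X ⟶ X.prod X) ≫ F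
      rw [Category.assoc, Category.assoc, h1F, Limits.comp_zero, Limits.comp_zero, Limits.zero_comp]
    · change ((𝟙 (X.prod X) - e₀) ≫ ψ₀ ≫ (𝟙 (X.prod X) - e₀)) ≫ S = (0 : X.prod X ⟶ X.prod X) ≫ S
      rw [Category.assoc, Category.assoc, h1S, hψS, h1F, Limits.zero_comp]

/-- **Given ANY abelian sixfold, the first five conjuncts of S1's anchor block are witnessed in the
tree** (`A₀ = X × X`, `dim_prod`): the F2 obstruction to writing down an anchor is purely
cohomological (`h₀`: rationality, `N¹`, `ψ₀^* h₀ = 11 h₀`, non-degeneracy, Kähler, the hyperbolic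
12-frame — all need Künneth for `complexBetti`). [folklore] -/
theorem exists_twelvefold_offDiagonal_of_sixfold (X : AbelianVariety ℂ) (hX : X.dim = 6) :
    ∃ (A₀ : AbelianVariety ℂ) (ψ₀ e₀ : A₀ ⟶ A₀), A₀.dim = 12 ∧ ψ₀ ≫ ψ₀ = -((11 : ℤ) • 𝟙 A₀) ∧
      e₀ ≫ e₀ = e₀ ∧ e₀ ≫ ψ₀ ≫ e₀ = 0 ∧ (𝟙 A₀ - e₀) ≫ ψ₀ ≫ (𝟙 A₀ - e₀) = 0 := by
  obtain ⟨ψ₀, e₀, h1, h2, h3, h4⟩ := exists_offDiagonal_on_square X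
  exact ⟨X.prod X, ψ₀, e₀, by rw [AbelianVariety.dim_prod, hX], h1, h2, h3, h4⟩

/-! ### S2 `stub_moduliReach`: its conclusion is `HWA(11, 6)` on hyperbolic polarised members -/

/-- **`HWA(11, 6)` (the rung predicate of dimension 12, typed verbatim as in `HodgeWeilLadder` /
`KillPropagation`) implies the conclusion block of `stub_moduliReach`** (VERBATIM below; its six
polarisation / hyperbolicity hypotheses are simply dropped). [folklore] -/
theorem stubModuliReachCore_of_hwa11_six
    (h6 : ∀ (A : AbelianVariety ℂ) (φ : A ⟶ A), A.dim = (2 * 6) →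
        φ ≫ φ = -((((11 : ℕ) : ℤ)) • 𝟙 A) →
        ∀ c : complexBetti A.X (2 * 6), IsRationalClass c → IsOfHodgeType (2 * 6) A.X (2 * 6) 6 6 c →
          c ∈ Module.End.eigenspace (complexBetti.map (𝟙 A + φ).hom.hom.hom (2 * 6)).hom
                ((1 + Complex.I * (Real.sqrt ((11 : ℕ) : ℝ) : ℂ)) ^ (2 * 6)) ⊔
              Module.End.eigenspace (complexBetti.map (𝟙 A + φ).hom.hom.hom (2 * 6)).hom
                ((1 - Complex.I * (Real.sqrt ((11 : ℕ) : ℝ) : ℂ)) ^ (2 * 6)) →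
          c ∈ algebraicClasses A.X 6) :
    ∀ (X : AbelianVariety ℂ) (ψ : X ⟶ X), X.dim = 12 → ψ ≫ ψ = -((11 : ℤ) • 𝟙 X) →
    ∀ h : complexBetti X.X 2, IsRationalClass h → h ∈ algebraicClasses X.X 1 →
      complexBetti.map ψ.hom.hom.hom 2 h = (11 : ℂ) • h →
      (∀ x : complexBetti X.X 1,
        (∀ y : complexBetti X.X 1, polarizationPairingOne X.X h 11 x y = 0) → x = 0) →
      IsKaehlerClass 12 X.X h → IsHyperbolicWeilType X ψ 6 h →
    ∀ c : complexBetti X.X 12, IsRationalClass c → IsOfHodgeType 12 X.X 12 6 6 c →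
      c ∈ Module.End.eigenspace (complexBetti.map (𝟙 X + ψ).hom.hom.hom 12).hom
            ((1 + Complex.I * (Real.sqrt (11 : ℝ) : ℂ)) ^ 12) ⊔
          Module.End.eigenspace (complexBetti.map (𝟙 X + ψ).hom.hom.hom 12).hom
            ((1 - Complex.I * (Real.sqrt (11 : ℝ) : ℂ)) ^ 12) →
      c ∈ algebraicClasses X.X 6 := by
  intro X ψ hdim hψ h _ _ _ _ _ _ c hrat hhodge hweil
  have h' := h6 X ψ hdim (by simpa using hψ) c hrat hhodge
  simpa using h' (by simpa using hweil)

/-- … hence the conclusion block of `stub_moduliReach` follows from the summit. [cite: Deligne2000, §1] -/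
theorem stubModuliReachCore_of_hodgeConjecture (hHC : _root_.HodgeConjecture) :
    ∀ (X : AbelianVariety ℂ) (ψ : X ⟶ X), X.dim = 12 → ψ ≫ ψ = -((11 : ℤ) • 𝟙 X) →
    ∀ h : complexBetti X.X 2, IsRationalClass h → h ∈ algebraicClasses X.X 1 →
      complexBetti.map ψ.hom.hom.hom 2 h = (11 : ℂ) • h →
      (∀ x : complexBetti X.X 1,
        (∀ y : complexBetti X.X 1, polarizationPairingOne X.X h 11 x y = 0) → x = 0) →
      IsKaehlerClass 12 X.X h → IsHyperbolicWeilType X ψ 6 h →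
    ∀ c : complexBetti X.X 12, IsRationalClass c → IsOfHodgeType 12 X.X 12 6 6 c →
      c ∈ Module.End.eigenspace (complexBetti.map (𝟙 X + ψ).hom.hom.hom 12).hom
            ((1 + Complex.I * (Real.sqrt (11 : ℝ) : ℂ)) ^ 12) ⊔
          Module.End.eigenspace (complexBetti.map (𝟙 X + ψ).hom.hom.hom 12).hom
            ((1 - Complex.I * (Real.sqrt (11 : ℝ) : ℂ)) ^ 12) →
      c ∈ algebraicClasses X.X 6 := by
  intro X ψ hdim _ h _ _ _ _ _ _ c hrat hhodge _
  have hsp : IsSmoothProjective 12 X.X := hdim ▸ (AbelianVariety.isSmoothProjective_holds (A := X))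
  exact (hHC hsp).2 6 c hrat hhodge

/-- **The route's own target and descending lemma give `HWA(11, 6)`**: rung `(11, 3)` of `HodgeWeilLadder` is
`HWA(11, 10)` (`rung11_of_hodgeWeilLadder`), and `WeilDescending` lowers `10 → 6` (`descend_logic`). NB dimension
`12` is not itself a Hecke–Prym rung (`6 ∉ 5ℕ`). [folklore] -/
theorem hwa11_six_of_ladder (hL : HodgeWeilLadder) (hD : WeilDescending) :
    ∀ (A : AbelianVariety ℂ) (φ : A ⟶ A), A.dim = (2 * 6) →
        φ ≫ φ = -((((11 : ℕ) : ℤ)) • 𝟙 A) →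
        ∀ c : complexBetti A.X (2 * 6), IsRationalClass c → IsOfHodgeType (2 * 6) A.X (2 * 6) 6 6 c →
          c ∈ Module.End.eigenspace (complexBetti.map (𝟙 A + φ).hom.hom.hom (2 * 6)).hom
                ((1 + Complex.I * (Real.sqrt ((11 : ℕ) : ℝ) : ℂ)) ^ (2 * 6)) ⊔
              Module.End.eigenspace (complexBetti.map (𝟙 A + φ).hom.hom.hom (2 * 6)).hom
                ((1 - Complex.I * (Real.sqrt ((11 : ℕ) : ℝ) : ℂ)) ^ (2 * 6)) →
          c ∈ algebraicClasses A.X 6 :=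
  descend_logic _ (hD 11 (by norm_num) (by norm_num) (by norm_num)) (by norm_num) (by norm_num : 6 ≤ 10)
    (rung11_of_hodgeWeilLadder hL (g := 3) (by norm_num) 10 (by norm_num))

/-! ### S6 `stub_descent` is weaker than the crux -/

/-- **The crux implies the conclusion block of `stub_descent`** (VERBATIM below, minus the leading
`type_of% stub_hodgeTypeExterior →`): forget the partner surface `B`, the descent pair and the twelvefold
hypothesis. So S6 is never the obstacle of the line: `¬S6 → ¬crux`. [folklore] -/
theorem stubDescentCore_of_weilTenfoldsSqrtMinus11 (h : WeilTenfoldsSqrtMinus11) :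
    ∀ (A : AbelianVariety ℂ) (φ : A ⟶ A) (B : AbelianVariety ℂ) (φB : B ⟶ B),
      A.dim = 10 → B.dim = 2 → φ ≫ φ = -((11 : ℤ) • 𝟙 A) → φB ≫ φB = -((11 : ℤ) • 𝟙 B) →
      (∃ bp bm η : complexBetti B.X 2,
        bp ∈ Module.End.eigenspace (complexBetti.map (𝟙 B + φB).hom.hom.hom 2).hom
              ((1 + Complex.I * (Real.sqrt (11 : ℝ) : ℂ)) ^ 2) ∧
        bm ∈ Module.End.eigenspace (complexBetti.map (𝟙 B + φB).hom.hom.hom 2).hom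
              ((1 - Complex.I * (Real.sqrt (11 : ℝ) : ℂ)) ^ 2) ∧
        IsRationalClass (bp + bm) ∧ IsOfHodgeType 2 B.X 2 1 1 (bp + bm) ∧
        η ∈ algebraicClasses B.X 1 ∧
        cupProduct (show 2 + 2 = 4 from rfl) bp η ≠ 0 ∧
        cupProduct (show 2 + 2 = 4 from rfl) bm η ≠ 0) →
      (∀ u : complexBetti (A.prod B).X 12, IsRationalClass u →
        IsOfHodgeType 12 (A.prod B).X 12 6 6 u →
        u ∈ Module.End.eigenspace (complexBetti.map (𝟙 (A.prod B) +
                AbelianVariety.prodLift (AbelianVariety.fst A B ≫ φ)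
                  (AbelianVariety.snd A B ≫ φB)).hom.hom.hom 12).hom
              ((1 + Complex.I * (Real.sqrt (11 : ℝ) : ℂ)) ^ 12) ⊔
            Module.End.eigenspace (complexBetti.map (𝟙 (A.prod B) +
                AbelianVariety.prodLift (AbelianVariety.fst A B ≫ φ)
                  (AbelianVariety.snd A B ≫ φB)).hom.hom.hom 12).hom
              ((1 - Complex.I * (Real.sqrt (11 : ℝ) : ℂ)) ^ 12) →
        u ∈ algebraicClasses (A.prod B).X 6) →
      ∀ c : complexBetti A.X 10, IsRationalClass c → IsOfHodgeType 10 A.X 10 5 5 c →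
        c ∈ Module.End.eigenspace (complexBetti.map (𝟙 A + φ).hom.hom.hom 10).hom
              ((1 + Complex.I * (Real.sqrt (11 : ℝ) : ℂ)) ^ 10) ⊔
            Module.End.eigenspace (complexBetti.map (𝟙 A + φ).hom.hom.hom 10).hom
              ((1 - Complex.I * (Real.sqrt (11 : ℝ) : ℂ)) ^ 10) →
        c ∈ algebraicClasses A.X 5 :=
  fun A φ _ _ hA _ hφ _ _ _ c hrat hhodge hweil => h A φ hA hφ c hrat hhodge hweil

end Summit.HodgeConjecture.HodgeConjecture.Theorems.WeilTenfoldsSqrtMinus11.Negative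

end
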